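import Summits.HodgeConjecture.CorCM.PairwiseCMFamiliesHodge
import Summits.HodgeConjecture.CorCM.QuadraticCMFamiliesNonisogenous
import Literature.AlgebraicGeometry.Pohlmann1968.CMTypeRankLowerBoundsNumberField
import Literature.AlgebraicGeometry.Pohlmann1968.SimpleCMAbelianVarietyPowersDivisorGenerated
import HarnessLib

/-!
# Pairwise partial conjugations suffice: CM elliptic curves times simple CM abelian varieties of dimension `≤ 3` under
# PAIRWISE real-intersection conditions

COR-CM (cell `pub-hodgecm2`, seat p2 gen 17, count-neutral claim MASTER-CC (F6)); NEW as stated, hence under `Summits/`.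
Theorems only; no definition, no named fact, no `sorry`.

Second menu for the pairwise criterion of `CMTypeRankCommonConstituent` (F4) /`PairwiseCMFamiliesHodge` (F5).  In F5's
menu the pairs (imaginary quadratic slot `j`, non-quadratic slot `b`) were settled by (□) at `b` (complex conjugation on
`Hom(K_b, ℂ)` a square in `Aut(ℂ)`).  Here they are settled — like the pairs of non-quadratic slots — by a PAIRWISE
PARTIAL CONJUGATION: some `σ ∈ Aut(ℂ)` acting as complex conjugation on `Hom(K_a, ℂ)` and trivially on `Hom(K_b, ℂ)`
(F4's `pairwise_of_partialConj`; nothing is asked on the other slots).  By b23's two-slot criterion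
(`forall_exists_partialConj_pair`) such a `σ` exists as soon as complex conjugation fixes `L_a ∩ L_b` pointwise — for an
imaginary quadratic `K_a = k_a` simply: `k_a ⊄ L_b`.  This is MUCH weaker than the slot-by-slot condition of
`CMTypeRankPartialConjugation` / `RealIntersectionCMFieldsHodge` ("`L_b ∩` (compositum of ALL the other closures) totally
real"), which fails e.g. for `ℚ(√-1), ℚ(√-2), ℚ(√-6), ℚ(ζ₉)`: the compositum `ℚ(√-1, √-2, √-6) = ℚ(i, √2, √3)` contains
`√-3 ∈ ℚ(ζ₉)`, and (□) fails for `ℚ(ζ₉)` (cyclic of order `6`), and no partial conjugation at any slot exists — yet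
PAIRWISE `ℚ(√-d) ⊄ ℚ(ζ₉)` for `d = 1, 2, 6` and the sign characters are distinct, so the family is nondegenerate
(Deligne's rank `7`, maximal) and `B• = D•` holds on all `E_1^a × E_2^b × E_6^c × A^d`.

* `pairwise_of_menu₂` — quadratic pairs: distinct sign characters; every pair `(a, b)` with `b` non-quadratic: a
  pairwise partial conjugation (conjugation on `a`, identity on `b`);
* `isNondegenerateFamily_iff_of_menu₂`, `hodgeConjectureFor_prod_of_menu₂`, `hodgeClassSpan_prod_eq_divisorClassesSpan_of_menu₂`;
* **`hodgeConjectureFor_prod_curves_of_pairwise_realIntersection`** — the Hodge conjecture for every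
  `E_1^{a_1} × ⋯ × E_r^{a_r} × A_1^{c_1} × ⋯ × A_m^{c_m}` (every `⨁_{k<N} A_{π k}`) with `E_j` pairwise non-isogenous CM
  elliptic curves (separating quadratic sub-family) and `A_b` realisations of NONDEGENERATE types of CM fields `K_b` such
  that, for every `b` and every `a ≠ b` (curve or not), complex conjugation fixes `L_a ∩ L_b` pointwise;
* **`hodgeConjectureFor_prod_curves_simple_of_pairwise_realIntersection`** — the same with `A_b` SIMPLE of dimension
  `≤ 3` (`[K_b : ℚ] = 2 dim A_b ≤ 6`: primitive types of degree `≤ 6` are nondegenerate, Ribet's bound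
  `Pohlmann1968.isNondegenerate_of_isPrimitive_of_finrank_le_six`) — unconditionally, no named fact;
* **`hodgeConjectureFor_prod_curves_simple_of_pairwise_not_isIsogenous`** — the same with the hypotheses on the
  curves AS PRINTED in Moonen–Zarhin Cor. (3.9): the `E_j` (`dim = 1`) are pairwise NON-ISOGENOUS (seat b16's
  `isSeparatingFamily_iff_pairwise_not_isIsogenous`, by name).

Sources: [Gordon1999HodgeAVSurvey] §3 (Imai–Murty), 7.5, 10.10; [MoonenZarhin1999LowDim] Cor. (3.9); [Ribet1980] (3.7);
[Shimura1998] §8.2 Prop. 26.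
-/

noncomputable section

open CategoryTheory CategoryTheory.Limits NumberField NumberField.ComplexEmbedding IntermediateField
open scoped BigOperators

namespace Summit.HodgeConjecture.CorCM

open Literature.NumberTheory.ComplexMultiplication
open Literature.AlgebraicGeometry.Motives (AbelianVariety CMType)
open Literature.AlgebraicGeometry.HodgeTheory
open Literature.AlgebraicGeometry.ComplexMultiplication (IsCMTypeRealisation isSimple_iff_isPrimitive)
open Literature.AlgebraicGeometry.VanGeemen1994 (hodgeClassSpan)
open Literature.AlgebraicGeometry.Pohlmann1968
open Literature.Barriers.HodgeConjecture (divisorClassesSpan)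

section Fields

variable {I : Type} {K : I → Type} [∀ i, Field (K i)] [∀ i, NumberField (K i)] [∀ i, IsCMField (K i)]

/-- **The second menu.**  The pairwise criterion holds for a family whose slots off `B = {i | p i}` are imaginary
quadratic, pairwise distinguished by some automorphism of `ℂ`, and such that every pair `(a, b)` with `b ∈ B`, `a ≠ b`
carries a pairwise partial conjugation (complex conjugation on `Hom(K_a, ℂ)`, the identity on `Hom(K_b, ℂ)`).
[cite: Gordon1999HodgeAVSurvey, §3 Theorem (proof)] -/
theorem pairwise_of_menu₂ (p : I → Prop) (Φ : ∀ i, CMType (K i))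
    (h2 : ∀ j, ¬p j → Module.finrank ℚ (K j) = 2)
    (hχ : ∀ i j, ¬p i → ¬p j → i ≠ j → ∃ g : ℂ ≃+* ℂ,
      ¬((∀ s : K i →+* ℂ, g • s = s) ↔ ∀ s : K j →+* ℂ, g • s = s))
    (hpc : ∀ a b, p b → a ≠ b →
      ∃ σ : ℂ ≃+* ℂ, (∀ s : K a →+* ℂ, σ • s = conjugate s) ∧ ∀ s : K b →+* ℂ, σ • s = s) :
    ∀ i j, i ≠ j → ∀ P : Submodule ℚ ((K i →+* ℂ) → ℚ), P ≤ antiSpan (ℂ ≃+* ℂ) (Φ i).1 →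
      (∀ g : ℂ ≃+* ℂ, ∀ f ∈ P, (fun x => f (g • x)) ∈ P) →
      ∀ T : ((K i →+* ℂ) → ℚ) →ₗ[ℚ] ((K j →+* ℂ) → ℚ),
        (∀ g : ℂ ≃+* ℂ, ∀ f ∈ P, T (fun x => f (g • x)) = fun y => T f (g • y)) →
        (∀ f ∈ P, T f ∈ antiSpan (ℂ ≃+* ℂ) (Φ j).1) → (∀ f ∈ P, T f = 0 → f = 0) → P = ⊥ := by
  classical
  have hCM : ∀ i, IsCMTypeWith (starRingAut : ℂ ≃+* ℂ) (Φ i).1 := fun i => isCMTypeWith_conj (Φ i)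
  have hc : ∀ j, ¬p j → Fintype.card (K j →+* ℂ) = 2 := fun j hj => by rw [Embeddings.card, h2 j hj]
  -- pairs with a partial conjugation, in both orders
  have hconj : ∀ a b, p b → a ≠ b → ∀ i j, (i = a ∧ j = b ∨ i = b ∧ j = a) →
      ∀ P : Submodule ℚ ((K i →+* ℂ) → ℚ), P ≤ antiSpan (ℂ ≃+* ℂ) (Φ i).1 →
        (∀ g : ℂ ≃+* ℂ, ∀ f ∈ P, (fun x => f (g • x)) ∈ P) →
        ∀ T : ((K i →+* ℂ) → ℚ) →ₗ[ℚ] ((K j →+* ℂ) → ℚ),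
          (∀ g : ℂ ≃+* ℂ, ∀ f ∈ P, T (fun x => f (g • x)) = fun y => T f (g • y)) →
          (∀ f ∈ P, T f ∈ antiSpan (ℂ ≃+* ℂ) (Φ j).1) → (∀ f ∈ P, T f = 0 → f = 0) → P = ⊥ := by
    intro a b hb hab i j hij
    obtain ⟨σ, hσa, hσb⟩ := hpc a b hb hab
    have key := pairwise_of_partialConj (G := ℂ ≃+* ℂ) (Φ := fun i => (Φ i).1) hCM (i := a) (j := b) (σ := σ)
      (fun s => by rw [hσa s, conj_smul_eq_conjugate]) hσb
    rcases hij with ⟨rfl, rfl⟩ | ⟨rfl, rfl⟩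
    · exact key.1
    · exact key.2
  intro i j hij
  by_cases hj : p j
  · exact hconj i j hj hij i j (Or.inl ⟨rfl, rfl⟩)
  by_cases hi : p i
  · exact hconj j i hi (Ne.symm hij) i j (Or.inr ⟨rfl, rfl⟩)
  -- two quadratic slots with different sign characters
  have hquad : ∀ j, ¬p j → ∀ f ∈ antiSpan (ℂ ≃+* ℂ) (Φ j).1, ∀ g : ℂ ≃+* ℂ,
      (fun x => f (g • x)) = TwoSlot.slotSign (ℂ ≃+* ℂ) (fun i => K i →+* ℂ) j g • f := fun j hj f hf g =>
    PairwiseCC.comp_smul_eq_slotSign_smul (Φ := fun i => (Φ i).1) (hCM j) (hc j hj) hf g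
  have hne : ∃ g : ℂ ≃+* ℂ,
      TwoSlot.slotSign (ℂ ≃+* ℂ) (fun i => K i →+* ℂ) i g ≠ TwoSlot.slotSign (ℂ ≃+* ℂ) (fun i => K i →+* ℂ) j g := by
    obtain ⟨g, hg⟩ := hχ i j hi hj hij
    refine ⟨g, fun heq => hg ?_⟩
    rw [TwoSlot.forall_smul_eq_iff_slotSign_eq_one (G := ℂ ≃+* ℂ) (E := fun i => K i →+* ℂ)
        (Φ := fun i => (Φ i).1) (hCM i) (hc i hi) g,
      TwoSlot.forall_smul_eq_iff_slotSign_eq_one (G := ℂ ≃+* ℂ) (E := fun i => K i →+* ℂ)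
        (Φ := fun i => (Φ i).1) (hCM j) (hc j hj) g, heq]
  exact (pairwise_of_eigenvector (G := ℂ ≃+* ℂ) (Φ := fun i => (Φ i).1) (i := i) (j := j)
    (TwoSlot.slotSign (ℂ ≃+* ℂ) (fun i => K i →+* ℂ) i) (hquad i hi) fun f hf heig =>
      PairwiseCC.eq_zero_of_eigen_of_card_eq_two (Φ := fun i => (Φ i).1) (hCM j) (hc j hj) _ hne hf heig).1

variable [Fintype I] [DecidableEq I] [Nonempty I]

/-- **Nondegeneracy from the second menu**: the family is nondegenerate iff every non-quadratic member is.
[cite: Gordon1999HodgeAVSurvey, §3 Theorem and 7.5] -/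
theorem isNondegenerateFamily_iff_of_menu₂ (p : I → Prop) (Φ : ∀ i, CMType (K i))
    (h2 : ∀ j, ¬p j → Module.finrank ℚ (K j) = 2)
    (hχ : ∀ i j, ¬p i → ¬p j → i ≠ j → ∃ g : ℂ ≃+* ℂ,
      ¬((∀ s : K i →+* ℂ, g • s = s) ↔ ∀ s : K j →+* ℂ, g • s = s))
    (hpc : ∀ a b, p b → a ≠ b →
      ∃ σ : ℂ ≃+* ℂ, (∀ s : K a →+* ℂ, σ • s = conjugate s) ∧ ∀ s : K b →+* ℂ, σ • s = s) :
    CMAlgebra.IsNondegenerateFamily Φ ↔ ∀ b, p b → IsNondegenerate (Φ b) := by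
  rw [isNondegenerateFamily_iff_forall_of_pairwise Φ (pairwise_of_menu₂ p Φ h2 hχ hpc)]
  refine ⟨fun H b _ => H b, fun H i => ?_⟩
  by_cases hi : p i
  · exact H i hi
  · exact isNondegenerate_of_finrank_eq_two (Φ i) (h2 i hi)

end Fields

/-! ### Geometry -/

section Geometry

variable {I : Type} {K : I → Type} [∀ i, Field (K i)] [∀ i, NumberField (K i)] [∀ i, IsCMField (K i)] [Fintype I]
  [DecidableEq I] [Nonempty I] {Φ : ∀ i, CMType (K i)}
variable {A : I → AbelianVariety ℂ} {ι : ∀ i, 𝓞 (K i) →+* End (A i)}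
  {θ : ∀ i, K i →+* Module.End ℂ (complexBetti (A i).X 1)}

/-- **The Hodge conjecture from the second menu** (separating quadratic sub-family; pairwise partial conjugations
towards every non-quadratic slot; nondegenerate non-quadratic types). [cite: Gordon1999HodgeAVSurvey, §3 Theorem and 10.10] -/
theorem hodgeConjectureFor_prod_of_menu₂ (p : I → Prop) (h2 : ∀ j, ¬p j → Module.finrank ℚ (K j) = 2)
    (hsep : CMAlgebra.IsSeparatingFamily (fun j : {j // ¬p j} => Φ j.1))
    (hpc : ∀ a b, p b → a ≠ b →
      ∃ σ : ℂ ≃+* ℂ, (∀ s : K a →+* ℂ, σ • s = conjugate s) ∧ ∀ s : K b →+* ℂ, σ • s = s)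
    (hΦ : ∀ b, p b → IsNondegenerate (Φ b)) (hA : ∀ i, IsCMTypeRealisation (Φ i) (A i) (ι i) (θ i)) {N : ℕ}
    (π : Fin N → I) : HodgeConjectureFor (⨁ fun j : Fin N => A (π j)).dim (⨁ fun j : Fin N => A (π j)).X :=
  ((isNondegenerateFamily_iff_of_menu₂ p Φ h2 (exists_not_iff_of_isSeparatingFamily p Φ h2 hsep) hpc).2
    hΦ).hodgeConjectureFor_prod hA π

/-- **`Bᵐ ⊗ ℂ = Dᵐ ⊗ ℂ` from the second menu** (no exotic Hodge class on any `⨁_{k<N} A_{π k}`).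
[cite: Gordon1999HodgeAVSurvey, §3 Theorem (2) and 7.5] -/
theorem hodgeClassSpan_prod_eq_divisorClassesSpan_of_menu₂ (p : I → Prop)
    (h2 : ∀ j, ¬p j → Module.finrank ℚ (K j) = 2) (hsep : CMAlgebra.IsSeparatingFamily (fun j : {j // ¬p j} => Φ j.1))
    (hpc : ∀ a b, p b → a ≠ b →
      ∃ σ : ℂ ≃+* ℂ, (∀ s : K a →+* ℂ, σ • s = conjugate s) ∧ ∀ s : K b →+* ℂ, σ • s = s)
    (hΦ : ∀ b, p b → IsNondegenerate (Φ b)) (hA : ∀ i, IsCMTypeRealisation (Φ i) (A i) (ι i) (θ i)) {N : ℕ}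
    (π : Fin N → I) (m : ℕ) :
    hodgeClassSpan (⨁ fun j : Fin N => A (π j)).dim (⨁ fun j : Fin N => A (π j)).X m =
      divisorClassesSpan (⨁ fun j : Fin N => A (π j)).X (⨁ fun j : Fin N => A (π j)).dim m :=
  ((isNondegenerateFamily_iff_of_menu₂ p Φ h2 (exists_not_iff_of_isSeparatingFamily p Φ h2 hsep) hpc).2
    hΦ).hodgeClassSpan_prod_eq_divisorClassesSpan hA π m

/-- **The Hodge conjecture for every `E_1^{a_1} × ⋯ × E_r^{a_r} × A_1^{c_1} × ⋯ × A_m^{c_m}` under PAIRWISE real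
intersections**: `E_j` pairwise non-isogenous CM elliptic curves (separating quadratic sub-family off `B`), `A_b` (`b ∈ B`)
realisations of NONDEGENERATE types of CM fields `K_b`, and for every `b ∈ B` and every `a ≠ b` complex conjugation fixes
`L_a ∩ L_b` pointwise (for a curve: `k_a ⊄ L_b`) — unconditionally.  Covers `ℚ(√-1), ℚ(√-2), ℚ(√-6)` with a primitive
type of `ℚ(ζ₉)`, out of reach of (□), of slotwise independence and of the slot-by-slot real-intersection criterion.
[cite: Gordon1999HodgeAVSurvey, §3 Theorem and 10.10] [cite: MoonenZarhin1999LowDim, Cor. (3.9)] -/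
theorem hodgeConjectureFor_prod_curves_of_pairwise_realIntersection (p : I → Prop)
    (h2 : ∀ j, ¬p j → Module.finrank ℚ (K j) = 2) (hsep : CMAlgebra.IsSeparatingFamily (fun j : {j // ¬p j} => Φ j.1))
    (hreal : ∀ a b, p b → a ≠ b → ∀ x : ℂ, x ∈ normalClosure ℚ (K a) ℂ →
      x ∈ normalClosure ℚ (K b) ℂ → starRingEnd ℂ x = x)
    (hΦ : ∀ b, p b → IsNondegenerate (Φ b)) (hA : ∀ i, IsCMTypeRealisation (Φ i) (A i) (ι i) (θ i)) {N : ℕ}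
    (π : Fin N → I) : HodgeConjectureFor (⨁ fun j : Fin N => A (π j)).dim (⨁ fun j : Fin N => A (π j)).X :=
  hodgeConjectureFor_prod_of_menu₂ p h2 hsep (fun a b hb hab => exists_pairConj_of_conj_apply_eq hab (hreal a b hb hab))
    hΦ hA π

/-- **The Hodge conjecture for every product of pairwise non-isogenous CM elliptic curves and SIMPLE CM abelian varieties
of dimension `≤ 3` under pairwise real intersections** (`[K_b : ℚ] ≤ 6`, `A_b` simple: its type is primitive, hence
nondegenerate by Ribet's bound in degree `≤ 6`) — e.g. curves with CM by `ℚ(√-1), ℚ(√-2), ℚ(√-6)` and a simple CM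
threefold with CM by `ℚ(ζ₉)`; unconditionally, no named fact. [cite: Gordon1999HodgeAVSurvey, §3 Theorem and 10.10]
[cite: Ribet1980, §3 Examples (3.7) (p. 87)] [cite: Shimura1998, §8.2 Prop. 26] -/
theorem hodgeConjectureFor_prod_curves_simple_of_pairwise_realIntersection (p : I → Prop)
    (h2 : ∀ j, ¬p j → Module.finrank ℚ (K j) = 2) (hsep : CMAlgebra.IsSeparatingFamily (fun j : {j // ¬p j} => Φ j.1))
    (hreal : ∀ a b, p b → a ≠ b → ∀ x : ℂ, x ∈ normalClosure ℚ (K a) ℂ →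
      x ∈ normalClosure ℚ (K b) ℂ → starRingEnd ℂ x = x)
    (hA : ∀ i, IsCMTypeRealisation (Φ i) (A i) (ι i) (θ i)) (hS : ∀ b, p b → (A b).IsSimple)
    (h3 : ∀ b, p b → (A b).dim ≤ 3) {N : ℕ} (π : Fin N → I) :
    HodgeConjectureFor (⨁ fun j : Fin N => A (π j)).dim (⨁ fun j : Fin N => A (π j)).X :=
  hodgeConjectureFor_prod_curves_of_pairwise_realIntersection p h2 hsep hreal
    (fun b hb => isNondegenerate_of_isPrimitive_of_finrank_le_six (Φ b)
      (by rw [finrank_eq_two_mul_dim_of_isCMTypeRealisation (hA b)]; have := h3 b hb; omega)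
      (Classical.arbitrary (K b →+* ℂ)) ((isSimple_iff_isPrimitive (hA b) _).1 (hS b hb))) hA π

/-- **The Hodge conjecture for every `E_1^{a_1} × ⋯ × E_r^{a_r} × A_1^{c_1} × ⋯ × A_m^{c_m}`, `E_j` PAIRWISE NON-ISOGENOUS
CM elliptic curves, `A_b` SIMPLE CM abelian varieties of dimension `≤ 3`, under pairwise real intersections** — the
hypothesis on the curves as printed in Moonen–Zarhin Cor. (3.9) («no two of which are isogenous»; Kubota separation of
the quadratic sub-family is EQUIVALENT to it, seat b16's `isSeparatingFamily_iff_pairwise_not_isIsogenous`); all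
`E_j`, `A_b` given as realisations `(A_i, ι_i, θ_i)` of CM types `Φ_i` of CM fields `K_i` (`[K_j : ℚ] = 2` off `B`).
Unconditional, no named fact. [cite: MoonenZarhin1999LowDim, Cor. (3.9)] [cite: Gordon1999HodgeAVSurvey, §3 Theorem and 10.10]
[cite: Ribet1980, §3 Examples (3.7) (p. 87)] -/
theorem hodgeConjectureFor_prod_curves_simple_of_pairwise_not_isIsogenous (p : I → Prop)
    (h2 : ∀ j, ¬p j → Module.finrank ℚ (K j) = 2)
    (hreal : ∀ a b, p b → a ≠ b → ∀ x : ℂ, x ∈ normalClosure ℚ (K a) ℂ →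
      x ∈ normalClosure ℚ (K b) ℂ → starRingEnd ℂ x = x)
    (hA : ∀ i, IsCMTypeRealisation (Φ i) (A i) (ι i) (θ i))
    (hni : ∀ i j, ¬p i → ¬p j → i ≠ j → ¬AbelianVariety.IsIsogenous (A i) (A j))
    (hS : ∀ b, p b → (A b).IsSimple) (h3 : ∀ b, p b → (A b).dim ≤ 3) {N : ℕ} (π : Fin N → I) :
    HodgeConjectureFor (⨁ fun j : Fin N => A (π j)).dim (⨁ fun j : Fin N => A (π j)).X :=
  hodgeConjectureFor_prod_curves_simple_of_pairwise_realIntersection p h2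
    ((isSeparatingFamily_iff_pairwise_not_isIsogenous (Φ := fun j : {j // ¬p j} => Φ j.1) (fun j => h2 j.1 j.2)
        fun j => hA j.1).2 fun i j hij => hni i.1 j.1 i.2 j.2 fun h => hij (Subtype.ext h))
    hreal hA hS h3 π

end Geometry

end Summit.HodgeConjecture.CorCM

end
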